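import Mathlib
import HarnessLib
import Summits.HubbardSuperconductivity.HubbardSuperconductivity.Theorems.KLProgrammeCutCurrencyScaleWt
import Summits.HubbardSuperconductivity.HubbardSuperconductivity.Theorems.KLProgrammeC4aBareVertexStrings

/-!
# Route `KLProgramme` — ENGINE (stmt-HubbardSuperconductivity-20437 `KLRegimeEngineV17F2`), located #25 «(b)-PLAIN-UV-TAIL», cure (α),
# E1 item (i) for ALL LABEL STRINGS: the `klScaleWt_n`-weighted cut plain currency of the bare vertex at ANY `τ′ : Fin 4 → SectorLeg 1`
# (cell gate-hubbard-kl, seat hubbard-kl-k3c2-p2 g35; completes ✓-farm `…CutCurrencyScaleWt` to binder #6's `∀ τ′`)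

Binder #6 quantifies over all quartic label strings `τ′`.  For the bare vertex only the `(spin, charge)` TYPES of `τ′` matter:
* if two legs of `τ′` carry the same type, `W₄^c(V)(τ′, ·) ≡ 0` (`kernel_hubbardInteraction_eq_zero_of_type_eq`, `klbv_sectorisedKernel_freqMul_eq_zero_of_type_eq`);
* otherwise the types are a permutation `σ` of the vertex pattern's and `W₄^c(V)(τ′, x) = sign σ · W₄^c(V)(pattern, x ∘ σ⁻¹)`
  (`kernel_hubbardInteraction_vertexLegs_comp_perm` + reindexing; `klbv_sectorisedKernel_freqMul_eq_perm`), so every pinned weighted currency of `τ′`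
  is a pinned weighted currency of the pattern (pin moved to `σ q`, tuple-symmetric weights unchanged).
Hence **`klbv_scaleWtCurrency_uvCut_hubbardInteraction_le_allStrings`**: for `128 ≤ β ≤ M`, every scale `n`, torus `L`, `U`, EVERY `τ′`, pinned leg `q`, pin `y`,
`ε_x³ Σ_{x′ : x′_q = y} klScaleWt_n(S(x′))·‖W₄(S_ĝ V)(τ′; x′)‖ ≤ (|U|/24)·(8⁴ + 2·klScale klE0 n·(8·20000·8³))` — binder #6's row for the O(U) part `V` of `𝒱ₙ`, all
strings, β/M-uniform.  No definition; nothing asserts any row, (b), (C), K3, U₀, the window or superconductivity.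
References: BGM 2006 §2.1 (2.6a), §2.3 [cite: BenfattoGiulianiMastropietro2006].
-/

noncomputable section

namespace Summit.HubbardSuperconductivity.HubbardSuperconductivity.Theorems.KLRegimeSplit

set_option linter.dupNamespace false -- summit = problem name (single-conjunct summit), D-0017

open Finset Literature.MathematicalPhysics.QuantumLattice Literature.Probability.LatticeModels GrassmannAlgebra
open Summit.HubbardSuperconductivity.HubbardSuperconductivity.Theorems.EngineV8
open Summit.HubbardSuperconductivity.HubbardSuperconductivity.Theorems.KLProgrammeLegKernels
open Summit.HubbardSuperconductivity.HubbardSuperconductivity.Theorems.C4a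

variable {L M : ℕ} [NeZero L] [NeZero M]

/-! ## §1 Degenerate strings: a repeated `(spin, charge)` type kills the frequency-weighted kernel of `V` -/

omit [NeZero M] in
/-- **A repeated type kills `W₄^c(V)(τ′, ·)`**: if legs `i ≠ i′` of `τ′` have the same spin and the same charge, the `c`-weighted sectorised quartic kernel
of `V` at `τ′` vanishes identically. -/
theorem klbv_sectorisedKernel_freqMul_eq_zero_of_type_eq (β U : ℝ) (c : MatsubaraIdx M → ℂ) (τ' : Fin 4 → SectorLeg 1) {i i' : Fin 4} (hii' : i ≠ i')
    (hs : (τ' i).1.2 = (τ' i').1.2) (hc : (τ' i).2 = (τ' i').2) (x : Fin 4 → SpaceTimeIdx L M) :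
    sectorisedKernel L M β (fun (_ : Fin 1) (k : FreqMomentum L M) => c k.1) (hubbardInteraction L M β U) 4 τ' x = 0 := by
  rw [sectorisedKernel_def]
  refine Finset.sum_eq_zero (fun k _ => ?_)
  rw [kernel_hubbardInteraction_eq_zero_of_type_eq β U _ hii' (by exact hs) (by exact hc), mul_zero]

/-! ## §2 Non-degenerate strings are permutations of the vertex pattern -/

/-- The vertex pattern's slots read by the type index `![![0,1],![2,3]] s c`: spin `s`, charge `c`. -/
theorem klbv_pattern_typeIndex (s c : Fin 2) :
    ((![(((0 : Fin 1), (0 : Fin 2)), (0 : Fin 2)), ((0, 0), 1), ((0, 1), 0), ((0, 1), 1)] : Fin 4 → SectorLeg 1) ((![![(0 : Fin 4), 1], ![2, 3]] : Fin 2 → Fin 2 → Fin 4) s c)).1.2 = s ∧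
      ((![(((0 : Fin 1), (0 : Fin 2)), (0 : Fin 2)), ((0, 0), 1), ((0, 1), 0), ((0, 1), 1)] : Fin 4 → SectorLeg 1) ((![![(0 : Fin 4), 1], ![2, 3]] : Fin 2 → Fin 2 → Fin 4) s c)).2 = c := by
  fin_cases s <;> fin_cases c <;> exact ⟨rfl, rfl⟩

omit [NeZero L] in
omit [NeZero M] in
/-- `vertexLegs κ` read through the type index: slot `![![0,1],![2,3]] s c` is `((κ _, s), c)`. -/
theorem klbv_vertexLegs_typeIndex (κ : Fin 4 → FreqMomentum L M) (s c : Fin 2) :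
    vertexLegs L M κ ((![![(0 : Fin 4), 1], ![2, 3]] : Fin 2 → Fin 2 → Fin 4) s c) = ((κ ((![![(0 : Fin 4), 1], ![2, 3]] : Fin 2 → Fin 2 → Fin 4) s c), s), c) := by
  fin_cases s <;> fin_cases c <;> rfl

/-- The type index is injective on `Fin 2 × Fin 2`. -/
theorem klbv_typeIndex_injective {s s' c c' : Fin 2}
    (h : (![![(0 : Fin 4), 1], ![2, 3]] : Fin 2 → Fin 2 → Fin 4) s c = (![![(0 : Fin 4), 1], ![2, 3]] : Fin 2 → Fin 2 → Fin 4) s' c') : s = s' ∧ c = c' := by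
  fin_cases s <;> fin_cases c <;> fin_cases s' <;> fin_cases c' <;> simp_all

omit [NeZero M] in
/-- **The `c`-weighted kernel of `V` at a non-degenerate string is, up to sign, the pattern's kernel at the permuted positions.**  If the types of `τ′` are
pairwise distinct there is a permutation `σ` of `Fin 4` with `W₄^c(V)(τ′, x) = sign σ · W₄^c(V)(pattern, x ∘ σ⁻¹)` for all `x`. -/
theorem klbv_sectorisedKernel_freqMul_eq_perm (β U : ℝ) (c : MatsubaraIdx M → ℂ) (τ' : Fin 4 → SectorLeg 1)
    (hτ : ∀ i i' : Fin 4, (τ' i).1.2 = (τ' i').1.2 → (τ' i).2 = (τ' i').2 → i = i') :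
    ∃ σ : Equiv.Perm (Fin 4), ∀ x : Fin 4 → SpaceTimeIdx L M,
      sectorisedKernel L M β (fun (_ : Fin 1) (k : FreqMomentum L M) => c k.1) (hubbardInteraction L M β U) 4 τ' x =
        (Equiv.Perm.sign σ : ℂ) * sectorisedKernel L M β (fun (_ : Fin 1) (k : FreqMomentum L M) => c k.1) (hubbardInteraction L M β U) 4
          (![(((0 : Fin 1), (0 : Fin 2)), (0 : Fin 2)), ((0, 0), 1), ((0, 1), 0), ((0, 1), 1)] : Fin 4 → SectorLeg 1) (x ∘ σ.symm) := by
  classical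
  -- the type map is injective, hence a permutation
  obtain ⟨T, hT⟩ : ∃ T : Fin 4 → Fin 4, ∀ i, T i = (![![(0 : Fin 4), 1], ![2, 3]] : Fin 2 → Fin 2 → Fin 4) (τ' i).1.2 (τ' i).2 :=
    ⟨_, fun i => rfl⟩
  have hTinj : Function.Injective T := by
    intro i i' h
    rw [hT, hT] at h
    obtain ⟨hs, hc⟩ := klbv_typeIndex_injective h
    exact hτ i i' hs hc
  have hTbij : Function.Bijective T := Finite.injective_iff_bijective.mp hTinj
  obtain ⟨σ, hσT⟩ : ∃ σ : Equiv.Perm (Fin 4), ∀ i, σ i = T i := ⟨Equiv.ofBijective T hTbij, fun i => rfl⟩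
  refine ⟨σ, fun x => ?_⟩
  -- types through `σ`: spin and charge of leg `σ⁻¹ j` of `τ′` are those of slot `j` of the pattern
  have htype : ∀ j : Fin 4, (τ' (σ.symm j)).1.2 = ((![(((0 : Fin 1), (0 : Fin 2)), (0 : Fin 2)), ((0, 0), 1), ((0, 1), 0), ((0, 1), 1)] : Fin 4 → SectorLeg 1) j).1.2 ∧
      (τ' (σ.symm j)).2 = ((![(((0 : Fin 1), (0 : Fin 2)), (0 : Fin 2)), ((0, 0), 1), ((0, 1), 0), ((0, 1), 1)] : Fin 4 → SectorLeg 1) j).2 := by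
    intro j
    have h := klbv_pattern_typeIndex (τ' (σ.symm j)).1.2 (τ' (σ.symm j)).2
    have hj : (![![(0 : Fin 4), 1], ![2, 3]] : Fin 2 → Fin 2 → Fin 4) (τ' (σ.symm j)).1.2 (τ' (σ.symm j)).2 = j := by
      rw [← hT, ← hσT, Equiv.apply_symm_apply]
    rw [hj] at h
    exact ⟨h.1.symm, h.2.symm⟩
  -- the string of `τ′` with momenta `κ ∘ σ` is `vertexLegs κ ∘ σ`
  have hk : ∀ κ : Fin 4 → FreqMomentum L M,
      (fun i => ((((κ ∘ σ) i), (τ' i).1.2), (τ' i).2) : Fin 4 → HubbardFieldIdx L M) = vertexLegs L M κ ∘ σ := by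
    intro κ
    funext i
    have h1 := (htype (σ i)).1
    have h2 := (htype (σ i)).2
    rw [Equiv.symm_apply_apply] at h1 h2
    simp only [Function.comp_apply]
    rw [h1, h2]
    have hslot : ∀ j : Fin 4, vertexLegs L M κ j =
        ((κ j, ((![(((0 : Fin 1), (0 : Fin 2)), (0 : Fin 2)), ((0, 0), 1), ((0, 1), 0), ((0, 1), 1)] : Fin 4 → SectorLeg 1) j).1.2),
          ((![(((0 : Fin 1), (0 : Fin 2)), (0 : Fin 2)), ((0, 0), 1), ((0, 1), 0), ((0, 1), 1)] : Fin 4 → SectorLeg 1) j).2) := by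
      intro j; fin_cases j <;> rfl
    rw [hslot]
  -- reindex the momentum sum of the left side by `k = κ ∘ σ`
  rw [sectorisedKernel_def, sectorisedKernel_def, Finset.mul_sum]
  have hre : ∑ k : Fin 4 → FreqMomentum L M, (∏ i : Fin 4, c (k i).1 * hubbardPlaneWave L M β (τ' i).2 (k i) (x i)) *
        kernel ℂ (hubbardInteraction L M β U) 4 (fun i => ((k i, (τ' i).1.2), (τ' i).2)) =
      ∑ κ : Fin 4 → FreqMomentum L M, (∏ i : Fin 4, c ((κ ∘ σ) i).1 * hubbardPlaneWave L M β (τ' i).2 ((κ ∘ σ) i) (x i)) *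
        kernel ℂ (hubbardInteraction L M β U) 4 (fun i => (((κ ∘ σ) i, (τ' i).1.2), (τ' i).2)) := by
    refine (Fintype.sum_equiv (Equiv.arrowCongr σ.symm (Equiv.refl (FreqMomentum L M))) _ _ (fun κ => ?_)).symm
    have he : (Equiv.arrowCongr σ.symm (Equiv.refl (FreqMomentum L M))) κ = κ ∘ σ := by
      funext i; simp [Equiv.arrowCongr_apply]
    rw [he]
  rw [hre]
  refine Finset.sum_congr rfl (fun κ _ => ?_)
  rw [hk κ, kernel_hubbardInteraction_vertexLegs_comp_perm, klbv_kernel_vertexPattern]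
  -- the plane-wave product: reindex by `σ`
  have hprod : (∏ i : Fin 4, c ((κ ∘ σ) i).1 * hubbardPlaneWave L M β (τ' i).2 ((κ ∘ σ) i) (x i)) =
      ∏ j : Fin 4, c (κ j).1 * hubbardPlaneWave L M β ((![(((0 : Fin 1), (0 : Fin 2)), (0 : Fin 2)), ((0, 0), 1), ((0, 1), 0), ((0, 1), 1)] : Fin 4 → SectorLeg 1) j).2 (κ j) ((x ∘ σ.symm) j) := by
    rw [← Equiv.prod_comp σ.symm]
    refine Finset.prod_congr rfl (fun j _ => ?_)
    simp only [Function.comp_apply, Equiv.apply_symm_apply, (htype j).2]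
  rw [hprod]
  ring

/-! ## §3 Pinned weighted currencies of an arbitrary string -/

/-- **Reindexing a pinned tuple sum by a permutation of the legs**: `Σ_{x : x_q = y} g(x ∘ σ⁻¹) = Σ_{x′ : x′_{σ q} = y} g(x′)`. -/
theorem klbv_sum_pinned_comp_perm {P : Type*} [Fintype P] [DecidableEq P] (g : (Fin 4 → P) → ℝ) (σ : Equiv.Perm (Fin 4)) (q : Fin 4) (y : P) :
    ∑ x ∈ univ.filter (fun x : Fin 4 → P => x q = y), g (x ∘ σ.symm) = ∑ x ∈ univ.filter (fun x : Fin 4 → P => x (σ q) = y), g x := by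
  classical
  rw [Finset.sum_filter, Finset.sum_filter]
  rw [← Fintype.sum_equiv (Equiv.arrowCongr σ (Equiv.refl P)) (fun x : Fin 4 → P => if x q = y then g (x ∘ σ.symm) else 0)
    (fun x : Fin 4 → P => if x (σ q) = y then g x else 0) (fun x => ?_)]
  have he : (Equiv.arrowCongr σ (Equiv.refl P)) x = x ∘ σ.symm := by
    funext j; simp [Equiv.arrowCongr_apply]
  rw [he]
  simp only [Function.comp_apply, Equiv.symm_apply_apply]

/-- **THE `klScaleWt_n`-WEIGHTED CUT PLAIN CURRENCY OF THE BARE VERTEX AT EVERY LABEL STRING, UNIFORMLY** (`128 ≤ β ≤ M`; every scale `n`, `L`, `U`,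
`τ′ : Fin 4 → SectorLeg 1`, pinned leg `q`, pin `y`):
`ε_x³ Σ_{x′ : x′_q = y} klScaleWt_n((univ.image x′).image emb)·‖W₄(S_ĝ V)(τ′; x′)‖ ≤ (|U|/24)·(8⁴ + 2·klScale klE0 n·(8·20000·8³))`. -/
theorem klbv_scaleWtCurrency_uvCut_hubbardInteraction_le_allStrings {β : ℝ} (hβ : 128 ≤ β) (hM : β ≤ M) (n : ℕ) (U : ℝ)
    (τ' : Fin 4 → SectorLeg 1) (q : Fin 4) (y : SpaceTimeIdx L M) :
    imagTimeWeight β M ^ 3 *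
        ∑ x ∈ univ.filter (fun x : Fin 4 → SpaceTimeIdx L M => x q = y),
          klScaleWt L M β n ((univ.image x).image (fun z : SpaceTimeIdx L M => (((((2 * (z.1 : ℕ) : ℕ)) : ZMod (2 * (2 * M)))), z.2))) *
          ‖sectorisedKernel L M β (trivialMultiplier L M)
            (ExteriorAlgebra.map (LinearMap.mulLeft ℂ (fun K : HubbardFieldIdx L M => ((gnScaleCutoff 4 klE0 1 |matsubaraFreq β M K.1.1.1| : ℝ) : ℂ))) (hubbardInteraction L M β U)) 4
            τ' x‖ ≤
      |U| / 24 * (8 ^ 4 + 2 * klScale klE0 n * (8 * 20000 * 8 ^ 3)) := by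
  classical
  have hΛ : 0 ≤ klScale klE0 n := (klth_klScale_pos n).le
  have hRHS : 0 ≤ |U| / 24 * (8 ^ 4 + 2 * klScale klE0 n * (8 * 20000 * 8 ^ 3)) := by positivity
  -- the cut vertex's plain kernels are the `ĝ`-weighted kernels of `V` (any string)
  have hbridge : ∀ (Ω : Fin 4 → SectorLeg 1) (x : Fin 4 → SpaceTimeIdx L M),
      sectorisedKernel L M β (trivialMultiplier L M)
          (ExteriorAlgebra.map (LinearMap.mulLeft ℂ (fun K : HubbardFieldIdx L M => ((gnScaleCutoff 4 klE0 1 |matsubaraFreq β M K.1.1.1| : ℝ) : ℂ))) (hubbardInteraction L M β U)) 4 Ω x =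
        sectorisedKernel L M β (fun (_ : Fin 1) (k : FreqMomentum L M) => (((gnScaleCutoff 4 klE0 1 |matsubaraFreq β M k.1| : ℝ) : ℂ))) (hubbardInteraction L M β U) 4 Ω x :=
    fun Ω x => klbv_sectorisedKernel_uvCut_hubbardInteraction_eq β U 4 Ω x
  by_cases hτ : ∀ i i' : Fin 4, (τ' i).1.2 = (τ' i').1.2 → (τ' i).2 = (τ' i').2 → i = i'
  · -- non-degenerate: a permutation of the pattern
    obtain ⟨σ, hσ⟩ := klbv_sectorisedKernel_freqMul_eq_perm (L := L) β U (fun i : MatsubaraIdx M => (((gnScaleCutoff 4 klE0 1 |matsubaraFreq β M i| : ℝ) : ℂ))) τ' hτ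
    have hsign : ‖((Equiv.Perm.sign σ : ℤˣ) : ℂ)‖ = 1 := by
      rcases Int.units_eq_one_or (Equiv.Perm.sign σ) with h | h <;> simp [h]
    -- each summand equals the pattern's weighted summand at the permuted tuple
    have hterm : ∀ x : Fin 4 → SpaceTimeIdx L M,
        klScaleWt L M β n ((univ.image x).image (fun z : SpaceTimeIdx L M => (((((2 * (z.1 : ℕ) : ℕ)) : ZMod (2 * (2 * M)))), z.2))) *
          ‖sectorisedKernel L M β (trivialMultiplier L M)
            (ExteriorAlgebra.map (LinearMap.mulLeft ℂ (fun K : HubbardFieldIdx L M => ((gnScaleCutoff 4 klE0 1 |matsubaraFreq β M K.1.1.1| : ℝ) : ℂ))) (hubbardInteraction L M β U)) 4 τ' x‖ =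
        (fun x' : Fin 4 → SpaceTimeIdx L M =>
          klScaleWt L M β n ((univ.image x').image (fun z : SpaceTimeIdx L M => (((((2 * (z.1 : ℕ) : ℕ)) : ZMod (2 * (2 * M)))), z.2))) *
          ‖sectorisedKernel L M β (trivialMultiplier L M)
            (ExteriorAlgebra.map (LinearMap.mulLeft ℂ (fun K : HubbardFieldIdx L M => ((gnScaleCutoff 4 klE0 1 |matsubaraFreq β M K.1.1.1| : ℝ) : ℂ))) (hubbardInteraction L M β U)) 4
            (![(((0 : Fin 1), (0 : Fin 2)), (0 : Fin 2)), ((0, 0), 1), ((0, 1), 0), ((0, 1), 1)] : Fin 4 → SectorLeg 1) x'‖) (x ∘ σ.symm) := by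
      intro x
      have hw : ((univ.image x).image (fun z : SpaceTimeIdx L M => (((((2 * (z.1 : ℕ) : ℕ)) : ZMod (2 * (2 * M)))), z.2))) =
          ((univ.image (x ∘ σ.symm)).image (fun z : SpaceTimeIdx L M => (((((2 * (z.1 : ℕ) : ℕ)) : ZMod (2 * (2 * M)))), z.2))) := by
        congr 1
        ext z
        simp only [Finset.mem_image, Finset.mem_univ, true_and, Function.comp_apply]
        constructor
        · rintro ⟨i, rfl⟩; exact ⟨σ i, by rw [Equiv.symm_apply_apply]⟩
        · rintro ⟨j, rfl⟩; exact ⟨σ.symm j, rfl⟩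
      simp only []
      rw [hw, hbridge, hbridge, hσ x, norm_mul, hsign, one_mul]
    rw [Finset.sum_congr rfl (fun x _ => hterm x), klbv_sum_pinned_comp_perm (fun x' : Fin 4 → SpaceTimeIdx L M =>
          klScaleWt L M β n ((univ.image x').image (fun z : SpaceTimeIdx L M => (((((2 * (z.1 : ℕ) : ℕ)) : ZMod (2 * (2 * M)))), z.2))) *
          ‖sectorisedKernel L M β (trivialMultiplier L M)
            (ExteriorAlgebra.map (LinearMap.mulLeft ℂ (fun K : HubbardFieldIdx L M => ((gnScaleCutoff 4 klE0 1 |matsubaraFreq β M K.1.1.1| : ℝ) : ℂ))) (hubbardInteraction L M β U)) 4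
            (![(((0 : Fin 1), (0 : Fin 2)), (0 : Fin 2)), ((0, 0), 1), ((0, 1), 0), ((0, 1), 1)] : Fin 4 → SectorLeg 1) x'‖) σ q y]
    exact klbv_scaleWtCurrency_uvCut_hubbardInteraction_le hβ hM n U (σ q) y
  · -- degenerate string: the kernel vanishes
    push Not at hτ
    obtain ⟨i, i', hs, hc, hii'⟩ := hτ
    have h0 : ∀ x : Fin 4 → SpaceTimeIdx L M, sectorisedKernel L M β (trivialMultiplier L M)
        (ExteriorAlgebra.map (LinearMap.mulLeft ℂ (fun K : HubbardFieldIdx L M => ((gnScaleCutoff 4 klE0 1 |matsubaraFreq β M K.1.1.1| : ℝ) : ℂ))) (hubbardInteraction L M β U)) 4 τ' x = 0 := by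
      intro x
      rw [hbridge]
      exact klbv_sectorisedKernel_freqMul_eq_zero_of_type_eq β U (fun i : MatsubaraIdx M => (((gnScaleCutoff 4 klE0 1 |matsubaraFreq β M i| : ℝ) : ℂ))) τ' hii' hs hc x
    rw [Finset.sum_eq_zero (fun x _ => by rw [h0 x, norm_zero, mul_zero]), mul_zero]
    exact hRHS

end Summit.HubbardSuperconductivity.HubbardSuperconductivity.Theorems.KLRegimeSplit

end
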